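/-
Chen 2024 (IACR ePrint 2024/555, version of 2024-04-18), §3.5.1 Step 1: Lemma 3.9 / `|φ₁⟩` p. 22–23, `|φ′₁⟩` and
Lemma 3.10 ("`|φ′₁⟩ ≈_t |φ₁⟩`") p. 23 with its proof p. 24, Lemma 2.11 p. 12 (`‖ϕ‖ ≥ µ`, `‖ϕ − ψ‖ ≤ δ ⇒ D ≤
O(√(δ/µ))`), Lemma 2.6 p. 11 (Banaszczyk tail), Cond. C.4 p. 19 (`2r log n ≤ P`), eq. (18) p. 24 (the `≈_t` of
Step 2).  AUTOPSY OF LEMMA 3.10 — the one place where the front end replaces the state the algorithm HAS (the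
line `{kx − y}` truncated to the box `(r log n)·B_∞ⁿ`) by the state the analysis USES (the whole line, reduced
mod `P`):  (1) a CORRECTED Lemma 3.10 with an explicit relative ℓ² error `δ(α,T)` for every outcome `y` whose box
contains the bulk `{k : |k − c| < T}` of the line (a theorem; it is exactly the hypothesis of the state-robustness
bound `abs_basisProb_sub_le` of `ChenQuantumLWEStateRobustness`, i.e. Lemma 2.11 with its `µ` supplied);
(2) the printed PER-OUTCOME statement is FALSE for outcomes at the boundary of the box (an explicit family and a
numerical instance: the two states are then almost orthogonal); (3) the printed proof bounds the ABSOLUTE ℓ¹ tail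
and `‖|φ₁⟩‖` from ABOVE, while Lemma 2.11 needs a LOWER bound `µ` — the quantity it loses is the factor
`C₀ = e^{-π‖y_⊥‖²/r²}` common to every amplitude of the line, which is `e^{-Θ(n)}` for typical outcomes.

REPRODUCTION / ANALYSIS OF A CLAIMED RESULT UNDER ADJUDICATION (withdrawn by its author, note of 2024-04-18).
HONEST FRAMING: the VALUE is a THEOREM / DECIDABLE VERDICT / CERTIFICATE / precise negative result — NOT
summit progress.  What is located here is a gap in the WRITE-UP of Step 1 (a missing "for all but a negligible
fraction of Step-1 outcomes" and a missing lower bound on `‖|φ₁⟩‖`), and the corrected statement closes it for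
the good outcomes; it is NOT the error that sinks the algorithm (the periodicity premise of Step 9,
`ChenQuantumLWESteps`).  Nothing is repaired beyond that, nothing is broken, no cryptanalytic claim.
No named fact is introduced (debt 0).
-/
import Literature.Computability.Cryptography.ChenQuantumLWEKarstWave
import Literature.Computability.Cryptography.ChenQuantumLWEStateRobustness
import Mathlib.Analysis.SpecificLimits.Basic
import Mathlib.Analysis.Complex.ExponentialBounds
import Mathlib.Analysis.Real.Pi.Bounds

/-!
# Chen 2024, Step 1: Lemma 3.10 (`|φ′₁⟩ ≈_t |φ₁⟩`) — corrected, quantified, and where it fails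

Step 1 (Lemma 3.9, p. 22–23) measures `y′ = v + y` and leaves
`|φ₁⟩ = Σ_{k∈ℤ, kx−y ∈ (r log n)B_∞ⁿ} e^{-π(1/r²+i/s²)‖kx−y‖²}|kx − y⟩` (`x` the shortest vector of `L`, `y ∈ ℤⁿ ∩
(r log n)B_∞ⁿ` fixed by the outcome); "for the convenience of Step 2" the paper passes to
`|φ′₁⟩ := Σ_{k∈ℤ} e^{-π(1/r²+i/s²)‖kx−y‖²}|kx − y mod P⟩` and asserts **Lemma 3.10: `|φ′₁⟩ ≈_t |φ₁⟩`**
(negligible trace distance, p. 12), "treating `|φ′₁⟩, |φ₁⟩` as unnormalized vectors over `ℂ^{ℤ_Pⁿ}`" (so `|φ₁⟩`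
is re-read mod `P`; by C.4, `2r log n ≤ P`, the box does not wrap).  The printed proof (p. 24): `‖|φ₁⟩‖₂² ≤
2r log n`; `‖|φ′₁⟩ − |φ₁⟩‖₁ ≤ Σ_{kx−y ∉ box} e^{-π‖kx−y‖²/r²} ∈ Σ_k e^{-π‖kx−y‖²/r²}·negl(n)` "(Lemma 2.6)" `∈ 2r·negl(n)`;
"therefore `‖|φ′₁⟩ − |φ₁⟩‖₂ ∈ negl(n)·‖|φ₁⟩‖₂`, so Lemma 3.10 follows Lemma 2.11."

Here `a := 1/r² + i/s²` is any complex rate with `Re a > 0`, the box is `{z : |zᵢ| ≤ R}` (`R = ⌊r log n⌋`), and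
everything is stated for general `x ≠ 0`, `y ∈ ℤⁿ`.  Write `c := ⟨x,y⟩/‖x‖²` (`lineCenter`), `α := Re(a)‖x‖²`
(`lineRate`), `y_⊥ := y − cx`, `C₀ := e^{-π Re(a)‖y_⊥‖²}` (`orthFactor`).  The organising identity is Pythagoras
along the line, `‖kx − y‖² = ‖x‖²(k − c)² + ‖y_⊥‖²` (`sum_sq_line_decomp`), whence
`|e^{-πa‖kx−y‖²}| = C₀·e^{-πα(k−c)²}` (`norm_lineAmp`): up to the COMMON factor `C₀` the line carries a
one-dimensional Gaussian of rate `α` centred at `c`.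

## What is proved

* `phi1` — `|φ₁⟩ ∈ ℂ^{ℤ_Pⁿ}` (the truncated line, read mod `P`); `phi1Prime` is the untruncated state of
  `ChenQuantumLWEKarstWave` (`phi1Prime_apply`).  `phi1Prime_sub_phi1`: `φ′₁(v) − φ₁(v)` is the sum over the
  OUT-OF-BOX line points reducing to `v`; `sum_norm_sq_phi1Prime_sub_phi1_le`: `‖|φ′₁⟩ − |φ₁⟩‖₂² ≤ (Σ_{kx−y ∉ box}
  |e^{-πa‖kx−y‖²}|)²` — the paper's `‖·‖₂ ≤ ‖·‖₁` step, unconditionally.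
* `gauss_tail_le` — the one-dimensional tail: `Σ_{k∈ℤ, |k−c| ≥ T} e^{-πα(k−c)²} ≤ B(α,T) := 2e^{-παT²}/(1 − e^{-2παT})`
  (`α, T > 0`, any centre; two geometric series).  `outOfBox_mass_le`: if the box contains every `k` with
  `|k − c| < T` ("the outcome is good at scale `T`"), the out-of-box mass is `≤ C₀·B(α,T)`.
* `eq_of_linePt_eq_of_inBox`, `phi1_apply_linePt` — for `2R < P` (C.4) reduction mod `P` is injective on the box,
  so `φ₁(k₁x − y mod P) = e^{-πa‖k₁x−y‖²}` for box points; `norm_sq_lineAmp_round_ge`: the term `k₁ = round(c)` has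
  `|·|² ≥ C₀² e^{-πα/2}` — the LOWER bound `µ` the printed proof lacks.
* **`lemma310_corrected`** — for `Re a > 0`, `x ≠ 0`, `2R < P`, `T > 1/2` and a good outcome at scale `T`:
  `‖|φ′₁⟩ − |φ₁⟩‖₂² ≤ δ(α,T)²·‖|φ₁⟩‖₂²`, `δ(α,T) := e^{πα/4}B(α,T) = 2e^{-πα(T²−1/4)}/(1 − e^{-2παT})` (`truncDelta`);
  `good_of_coordBound`: `T|xᵢ| + |(y_⊥)ᵢ| ≤ R ∀i` suffices for goodness; **`lemma310_qft`**: the same bound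
  after Step 2's `QFT_{ℤ_Pⁿ}` (Plancherel, `qft_norm_sq_sum`) — the `≈_t` of eq. (18) quantified;
  **`lemma310_basisProb`**: every Born probability of `|φ₁⟩` vs `|φ′₁⟩`, and of `QFT|φ₁⟩` vs `QFT|φ′₁⟩`, moves by
  at most `4δ(α,T)` (via `abs_basisProb_sub_le`, Lemma 2.11's role).
  In Chen's regime (C.1–C.7: `‖x‖ = u`, `r = ut³/(4 log n) ≫ u`, so `α = u²/r² = o(1)`; an outcome with
  `‖y_⊥‖_∞ ≤ R/2` is good at scale `T = R/(2‖x‖_∞)` by `good_of_coordBound`, and then `αT² ≥ log²n/4`,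
  `1/(1 − e^{-2παT}) ≤ 1 + 1/(2παT) = poly(n)`): `δ ≤ poly(n)·e^{-(π/4)log² n} = negl(n)` — Lemma 3.10 holds, with
  this `δ`, for those outcomes.  (This parenthesis is prose; the theorems are the displayed inequalities.)
* **`lemma310_fails_at_bad_outcome`** — the per-outcome statement is false in general: for `x = (1,…,1) ∈ ℤⁿ`
  (`n ≥ 3`), the box outcome `y = (−R, R, …, R)`, `0 < R`, `2R < P`: the box meets the line only in `k = 0`
  (`inBox_ones_bad_iff`), so `|φ₁⟩ ∝ |v₀⟩`, `v₀ = −y mod P`, and `Pr_{φ₁}[v₀] = 1` (`basisProb_phi1_ones_bad`), whereas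
  `Pr_{φ′₁}[v₀] ≤ (B(α,c)/(e^{-πα/4} − B(α,P−½)))²` with `c = R(n−2)/n`, `α = n·Re a` — exponentially small in `αc²`.
  Since `|φ₁⟩ ∝ |v₀⟩`, `Pr_{φ′₁}[v₀]` IS the squared overlap `|⟨φ₁|φ′₁⟩|²/(‖φ₁‖²‖φ′₁‖²)`, so the trace distance of
  the normalised states is `√(1 − Pr_{φ′₁}[v₀]) ≈ 1`: as far apart as states get.  **`lemma310_fails_numeric`**:
  `n = 3`, `R = 15`, `P = 31`, `a = 1/3`: `Pr_{φ₁}[v₀] = 1`, `Pr_{φ′₁}[v₀] < 2^{-200}`.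
  (In Chen's regime such outcomes — `‖y_⊥‖_∞` within `O(r√log n)` of `R = r log n` — have negligible
  probability, so the algorithm's Steps 1–2 are unaffected; the defect is the missing qualifier and the missing
  `µ`, not a new obstruction.  Prose, not formalised: it needs the outcome distribution of eq. (16)–(17).)

## What is NOT here

No statement about the PROBABILITY (over the Step-1 measurement, eq. (16)–(17)) that an outcome is good; no
trace-distance formula (we prove the ℓ² hypothesis of Lemma 2.11 / `abs_basisProb_sub_le` and its Born-rule
consequences, not `D ≤ O(√(δ/µ))` itself); no normalisation; no Lemma 2.15 (state-preparation error of the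
window, eq. (16)); Lemma 2.6 is replaced by the elementary one-dimensional bound `gauss_tail_le`, which is all
the line needs.
-/

namespace Literature.Computability.Cryptography.Chen2024

open scoped BigOperators Real
open Complex hiding exp continuous_exp exp_add exp_sub exp_neg exp_zero exp_ne_zero

noncomputable section

variable {n : ℕ}

/-! ### 1. The line `{kx − y}`: amplitudes, register values, the box -/

/-- The amplitude of the line point `k`: `F(k) := e^{-πa‖kx − y‖²}` (`a = 1/r² + i/s²` in the paper).
[cite: ChenQuantumLattice2024, Lemma 3.9 p. 22] -/
def lineAmp (a : ℂ) (x y : Fin n → ℤ) (k : ℤ) : ℂ :=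
  cexp (-π * a * ∑ i, ((k * x i - y i : ℤ) : ℂ) ^ 2)

/-- The register value of the line point `k`: `kx − y mod P ∈ ℤ_Pⁿ`. [cite: ChenQuantumLattice2024, §3.5.1 p. 23] -/
def linePt (P : ℕ) (x y : Fin n → ℤ) (k : ℤ) : Fin n → ZMod P :=
  fun i => ((k * x i - y i : ℤ) : ZMod P)

/-- `kx − y ∈ R·B_∞ⁿ`: the line point `k` lies in the box `{z : |zᵢ| ≤ R}` (`R = r log n`).
[cite: ChenQuantumLattice2024, Lemma 3.9 p. 22] -/
def InBox (R : ℕ) (x y : Fin n → ℤ) (k : ℤ) : Prop := ∀ i, |k * x i - y i| ≤ R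

/-- Box membership is decidable. [folklore] -/
instance instDecidablePredInBox (R : ℕ) (x y : Fin n → ℤ) : DecidablePred (InBox R x y) :=
  fun k => by unfold InBox; infer_instance

/-- **`|φ₁⟩`**, the state Step 1 actually leaves, read in `ℂ^{ℤ_Pⁿ}` as the proof of Lemma 3.10 does:
`φ₁(v) = Σ_{k : kx−y ≡ v (P), kx−y ∈ R·B_∞ⁿ} e^{-πa‖kx−y‖²}`. [cite: ChenQuantumLattice2024, Lemma 3.9 p. 22; Lemma 3.10 p. 23] -/
def phi1 (P R : ℕ) (a : ℂ) (x y : Fin n → ℤ) : Ket n P :=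
  fun v => ∑' k : ℤ, if linePt P x y k = v ∧ InBox R x y k then lineAmp a x y k else 0

/-- `|φ′₁⟩` of `ChenQuantumLWEKarstWave` in the present notation: `φ′₁(v) = Σ_{k : kx−y ≡ v (P)} F(k)`.
[cite: ChenQuantumLattice2024, §3.5.1 p. 23] -/
theorem phi1Prime_apply (P : ℕ) (a : ℂ) (x y : Fin n → ℤ) (v : Fin n → ZMod P) :
    phi1Prime P a x y v = ∑' k : ℤ, if linePt P x y k = v then lineAmp a x y k else 0 := rfl

/-- The line amplitudes are absolutely summable (`Re a > 0`, `x ≠ 0`). [folklore] -/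
theorem summable_lineAmp {a : ℂ} (ha : 0 < a.re) {x : Fin n → ℤ} (hx : x ≠ 0) (y : Fin n → ℤ) :
    Summable (lineAmp a x y) :=
  summable_lineWindow ha hx y

/-- `c = ⟨x,y⟩/‖x‖²`: the real parameter of the point of the line closest to `y`. [folklore] -/
def lineCenter (x y : Fin n → ℤ) : ℝ := ((x ⬝ᵥ y : ℤ) : ℝ) / ((x ⬝ᵥ x : ℤ) : ℝ)

/-- `α = Re(a)·‖x‖²`: the rate of the Gaussian in `k` along the line. [folklore] -/
def lineRate (a : ℂ) (x : Fin n → ℤ) : ℝ := a.re * ((x ⬝ᵥ x : ℤ) : ℝ)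

/-- `‖y_⊥‖² = ‖y‖² − ⟨x,y⟩²/‖x‖²`: the squared distance of `y` from the line `ℝx`. [folklore] -/
def orthDefect (x y : Fin n → ℤ) : ℝ := ((y ⬝ᵥ y : ℤ) : ℝ) - lineCenter x y ^ 2 * ((x ⬝ᵥ x : ℤ) : ℝ)

/-- `C₀ = e^{-π Re(a) ‖y_⊥‖²}`: the factor common to EVERY amplitude of the line. [folklore] -/
def orthFactor (a : ℂ) (x y : Fin n → ℤ) : ℝ := Real.exp (-π * a.re * orthDefect x y)

/-- `C₀ > 0`. [folklore] -/
theorem orthFactor_pos (a : ℂ) (x y : Fin n → ℤ) : 0 < orthFactor a x y := Real.exp_pos _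

/-- `‖x‖² > 0` for `x ≠ 0` in `ℤⁿ`. [folklore] -/
theorem dotProduct_self_pos_of_ne_zero {x : Fin n → ℤ} (hx : x ≠ 0) : 0 < ((x ⬝ᵥ x : ℤ) : ℝ) := by
  obtain ⟨i, hi⟩ := Function.ne_iff.mp hx
  have h : 0 < x ⬝ᵥ x := by
    unfold dotProduct
    exact Finset.sum_pos' (fun j _ => mul_self_nonneg _) ⟨i, Finset.mem_univ _, mul_self_pos.mpr hi⟩
  exact_mod_cast h

/-- `α = Re(a)‖x‖² > 0`. [folklore] -/
theorem lineRate_pos {a : ℂ} (ha : 0 < a.re) {x : Fin n → ℤ} (hx : x ≠ 0) : 0 < lineRate a x :=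
  mul_pos ha (dotProduct_self_pos_of_ne_zero hx)

/-- `‖kx − y‖² = k²‖x‖² − 2k⟨x,y⟩ + ‖y‖²` (eq. (18), second line). [cite: ChenQuantumLattice2024, eq. (18) p. 24] -/
theorem sum_sq_line_real (x y : Fin n → ℤ) (k : ℝ) :
    ∑ i, (k * (x i : ℝ) - (y i : ℝ)) ^ 2
      = k ^ 2 * ((x ⬝ᵥ x : ℤ) : ℝ) - 2 * k * ((x ⬝ᵥ y : ℤ) : ℝ) + ((y ⬝ᵥ y : ℤ) : ℝ) := by
  simp only [dotProduct]
  push_cast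
  rw [Finset.mul_sum, Finset.mul_sum, ← Finset.sum_sub_distrib, ← Finset.sum_add_distrib]
  exact Finset.sum_congr rfl fun i _ => by ring

/-- Pythagoras along the line: `‖kx − y‖² = ‖x‖²(k − c)² + ‖y_⊥‖²`. [folklore] -/
theorem sum_sq_line_decomp {x : Fin n → ℤ} (hx : x ≠ 0) (y : Fin n → ℤ) (k : ℝ) :
    ∑ i, (k * (x i : ℝ) - (y i : ℝ)) ^ 2
      = ((x ⬝ᵥ x : ℤ) : ℝ) * (k - lineCenter x y) ^ 2 + orthDefect x y := by
  have hX := (dotProduct_self_pos_of_ne_zero hx).ne'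
  rw [sum_sq_line_real, orthDefect, lineCenter]
  field_simp
  ring

/-- `‖y_⊥‖² = Σᵢ (c xᵢ − yᵢ)²`. [folklore] -/
theorem orthDefect_eq (x : Fin n → ℤ) (hx : x ≠ 0) (y : Fin n → ℤ) :
    orthDefect x y = ∑ i, (lineCenter x y * (x i : ℝ) - (y i : ℝ)) ^ 2 := by
  rw [sum_sq_line_decomp hx, sub_self]
  simp

/-- `‖y_⊥‖² ≥ 0`. [folklore] -/
theorem orthDefect_nonneg {x : Fin n → ℤ} (hx : x ≠ 0) (y : Fin n → ℤ) : 0 ≤ orthDefect x y := by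
  rw [orthDefect_eq x hx]
  positivity

/-- **The factorisation.** `|e^{-πa‖kx−y‖²}| = C₀ · e^{-πα(k−c)²}`. [cite: ChenQuantumLattice2024, eq. (18)(a) p. 24] -/
theorem norm_lineAmp (a : ℂ) {x : Fin n → ℤ} (hx : x ≠ 0) (y : Fin n → ℤ) (k : ℤ) :
    ‖lineAmp a x y k‖
      = orthFactor a x y * Real.exp (-π * lineRate a x * ((k : ℝ) - lineCenter x y) ^ 2) := by
  have hS : (∑ i, ((k * x i - y i : ℤ) : ℂ) ^ 2) = ((∑ i, ((k : ℝ) * (x i : ℝ) - (y i : ℝ)) ^ 2 : ℝ) : ℂ) := by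
    push_cast
    rfl
  rw [lineAmp, Complex.norm_exp, hS, orthFactor, lineRate, ← Real.exp_add]
  congr 1
  have hre : (-(π : ℂ) * a * ((∑ i, ((k : ℝ) * (x i : ℝ) - (y i : ℝ)) ^ 2 : ℝ) : ℂ)).re
      = -π * a.re * ∑ i, ((k : ℝ) * (x i : ℝ) - (y i : ℝ)) ^ 2 := by
    simp only [Complex.mul_re, Complex.neg_re, Complex.ofReal_re, Complex.neg_im, Complex.ofReal_im,
      mul_zero, sub_zero, Complex.mul_im, zero_mul, add_zero, neg_zero]
  rw [hre, sum_sq_line_decomp hx]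
  ring

/-! ### 2. A one-dimensional Gaussian tail bound over `ℤ` -/

/-- `B(α,T) := 2e^{-παT²}/(1 − e^{-2παT})`. [folklore] -/
def gaussTailBound (α T : ℝ) : ℝ :=
  2 * Real.exp (-π * α * T ^ 2) / (1 - Real.exp (-2 * π * α * T))

/-- `B(α,T) > 0`. [folklore] -/
theorem gaussTailBound_pos {α T : ℝ} (hα : 0 < α) (hT : 0 < T) : 0 < gaussTailBound α T := by
  have hρ : Real.exp (-2 * π * α * T) < 1 := Real.exp_lt_one_iff.mpr (by
    have : 0 < 2 * π * α * T := by positivity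
    linarith)
  unfold gaussTailBound
  exact div_pos (by positivity) (by linarith)

/-- The shifted Gaussian `k ↦ e^{-πα(k−c)²}` is summable over `ℤ` (`α > 0`). [folklore] -/
theorem summable_gauss_shift {α : ℝ} (hα : 0 < α) (c : ℝ) :
    Summable fun k : ℤ => Real.exp (-π * α * ((k : ℝ) - c) ^ 2) := by
  have hτ : 0 < (Complex.I * (α : ℂ)).im := by simpa using hα
  have hs : Summable fun k : ℤ => jacobiTheta₂_term k (-Complex.I * α * c) (Complex.I * α) :=
    (summable_jacobiTheta₂_term_iff _ _).mpr hτ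
  have hn := hs.norm
  refine (hn.mul_left (Real.exp (-π * α * c ^ 2))).congr fun k => ?_
  rw [jacobiTheta₂_term, Complex.norm_exp, ← Real.exp_add]
  congr 1
  have hre : (2 * π * Complex.I * k * (-Complex.I * α * c) + π * Complex.I * k ^ 2 * (Complex.I * α)).re
      = 2 * π * k * α * c - π * k ^ 2 * α := by
    have h1 : (2 * π * Complex.I * k * (-Complex.I * α * c) + π * Complex.I * k ^ 2 * (Complex.I * α))
        = ((2 * π * k * α * c - π * k ^ 2 * α : ℝ) : ℂ) := by
      push_cast
      ring_nf
      rw [Complex.I_sq]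
      ring
    rw [h1, Complex.ofReal_re]
  rw [hre]
  ring

/-- **Gaussian tail over `ℤ`.**  For `α > 0`, `T > 0` and any centre `c`:
`Σ_{k∈ℤ, |k−c| ≥ T} e^{-πα(k−c)²} ≤ 2e^{-παT²}/(1 − e^{-2παT})` (compare the `k`-th tail term, `k − c =
±(T + j + θ)`, `θ ≥ 0`, with `e^{-παT²}·(e^{-2παT})^j` and sum two geometric series). [folklore] -/
theorem gauss_tail_le {α : ℝ} (hα : 0 < α) (c : ℝ) {T : ℝ} (hT : 0 < T) :
    ∑' k : ℤ, (if T ≤ |(k : ℝ) - c| then Real.exp (-π * α * ((k : ℝ) - c) ^ 2) else 0)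
      ≤ gaussTailBound α T := by
  set ρ : ℝ := Real.exp (-2 * π * α * T) with hρdef
  set E : ℝ := Real.exp (-π * α * T ^ 2) with hEdef
  have hρ0 : 0 ≤ ρ := (Real.exp_pos _).le
  have hρ1 : ρ < 1 := Real.exp_lt_one_iff.mpr (by
    have : 0 < 2 * π * α * T := by positivity
    linarith)
  have hE0 : 0 ≤ E := (Real.exp_pos _).le
  set kp : ℤ := ⌈c + T⌉ with hkpdef
  set km : ℤ := ⌊c - T⌋ with hkmdef
  set gp : ℤ → ℝ := fun k => if kp ≤ k then E * ρ ^ (k - kp).toNat else 0 with hgpdef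
  set gm : ℤ → ℝ := fun k => if k ≤ km then E * ρ ^ (km - k).toNat else 0 with hgmdef
  have hgp0 : ∀ k, 0 ≤ gp k := fun k => by
    simp only [hgpdef]; split_ifs <;> positivity
  have hgm0 : ∀ k, 0 ≤ gm k := fun k => by
    simp only [hgmdef]; split_ifs <;> positivity
  have hgeo : HasSum (fun j : ℕ => E * ρ ^ j) (E * (1 - ρ)⁻¹) :=
    (hasSum_geometric_of_lt_one hρ0 hρ1).mul_left E
  -- the right tail is a geometric series pushed forward along `j ↦ kp + j`
  have hA : HasSum gp (E * (1 - ρ)⁻¹) := by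
    have hinj : Function.Injective fun j : ℕ => kp + (j : ℤ) := fun j j' h => by
      simpa using h
    have hoff : ∀ k, k ∉ Set.range (fun j : ℕ => kp + (j : ℤ)) → gp k = 0 := by
      intro k hk
      simp only [hgpdef]
      split_ifs with h
      · exact absurd ⟨(k - kp).toNat, by simp [Int.toNat_of_nonneg (sub_nonneg.mpr h)]⟩ hk
      · rfl
    rw [← hinj.hasSum_iff hoff]
    refine hgeo.congr_fun fun j => ?_
    simp only [Function.comp_apply, hgpdef]
    rw [if_pos (by omega)]
    congr 2
    omega
  -- the left tail, along `j ↦ km − j`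
  have hB : HasSum gm (E * (1 - ρ)⁻¹) := by
    have hinj : Function.Injective fun j : ℕ => km - (j : ℤ) := fun j j' h => by
      simpa using h
    have hoff : ∀ k, k ∉ Set.range (fun j : ℕ => km - (j : ℤ)) → gm k = 0 := by
      intro k hk
      simp only [hgmdef]
      split_ifs with h
      · exact absurd ⟨(km - k).toNat, by simp [Int.toNat_of_nonneg (sub_nonneg.mpr h)]⟩ hk
      · rfl
    rw [← hinj.hasSum_iff hoff]
    refine hgeo.congr_fun fun j => ?_
    simp only [Function.comp_apply, hgmdef]
    rw [if_pos (by omega)]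
    congr 2
    omega
  -- pointwise comparison
  have hkp : c + T ≤ (kp : ℝ) := Int.le_ceil _
  have hkm : (km : ℝ) ≤ c - T := Int.floor_le _
  have hpt : ∀ k : ℤ, (if T ≤ |(k : ℝ) - c| then Real.exp (-π * α * ((k : ℝ) - c) ^ 2) else 0)
      ≤ gp k + gm k := by
    intro k
    split_ifs with hk
    · rcases le_abs'.mp hk with h | h
      · -- left tail: `k − c ≤ −T`
        have hkle : k ≤ km := Int.le_floor.mpr (by linarith)
        have hj0 : (0 : ℤ) ≤ km - k := sub_nonneg.mpr hkle
        set j : ℕ := (km - k).toNat with hjdef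
        have hj : ((j : ℤ) : ℝ) = (km : ℝ) - k := by
          rw [hjdef, Int.toNat_of_nonneg hj0]; push_cast; ring
        have hj' : (j : ℝ) = (km : ℝ) - k := by exact_mod_cast hj
        have hdist : T + j ≤ c - k := by rw [hj']; linarith
        have hsq : T ^ 2 + 2 * T * j ≤ ((k : ℝ) - c) ^ 2 := by
          have hj0' : (0 : ℝ) ≤ j := Nat.cast_nonneg j
          nlinarith
        have hle : Real.exp (-π * α * ((k : ℝ) - c) ^ 2) ≤ E * ρ ^ j := by
          rw [hEdef, hρdef, ← Real.exp_nat_mul, ← Real.exp_add]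
          apply Real.exp_le_exp.mpr
          have hπα : 0 < π * α := by positivity
          nlinarith
        have hgmk : gm k = E * ρ ^ j := by simp only [hgmdef, if_pos hkle, hjdef]
        rw [hgmk]
        linarith [hgp0 k]
      · -- right tail: `T ≤ k − c`
        have hkge : kp ≤ k := Int.ceil_le.mpr (by linarith)
        have hj0 : (0 : ℤ) ≤ k - kp := sub_nonneg.mpr hkge
        set j : ℕ := (k - kp).toNat with hjdef
        have hj : ((j : ℤ) : ℝ) = (k : ℝ) - kp := by
          rw [hjdef, Int.toNat_of_nonneg hj0]; push_cast; ring
        have hj' : (j : ℝ) = (k : ℝ) - kp := by exact_mod_cast hj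
        have hdist : T + j ≤ k - c := by rw [hj']; linarith
        have hsq : T ^ 2 + 2 * T * j ≤ ((k : ℝ) - c) ^ 2 := by
          have hj0' : (0 : ℝ) ≤ j := Nat.cast_nonneg j
          nlinarith
        have hle : Real.exp (-π * α * ((k : ℝ) - c) ^ 2) ≤ E * ρ ^ j := by
          rw [hEdef, hρdef, ← Real.exp_nat_mul, ← Real.exp_add]
          apply Real.exp_le_exp.mpr
          have hπα : 0 < π * α := by positivity
          nlinarith
        have hgpk : gp k = E * ρ ^ j := by simp only [hgpdef, if_pos hkge, hjdef]
        rw [hgpk]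
        linarith [hgm0 k]
    · linarith [hgp0 k, hgm0 k]
  have hf0 : ∀ k : ℤ, 0 ≤ (if T ≤ |(k : ℝ) - c| then Real.exp (-π * α * ((k : ℝ) - c) ^ 2) else 0) :=
    fun k => by split_ifs <;> positivity
  have hfs : Summable fun k : ℤ =>
      (if T ≤ |(k : ℝ) - c| then Real.exp (-π * α * ((k : ℝ) - c) ^ 2) else 0) :=
    (hA.add hB).summable.of_nonneg_of_le hf0 hpt
  have hle := hasSum_le hpt hfs.hasSum (hA.add hB)
  have h1ρ : 0 < 1 - ρ := by linarith
  calc ∑' k : ℤ, (if T ≤ |(k : ℝ) - c| then Real.exp (-π * α * ((k : ℝ) - c) ^ 2) else 0)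
      ≤ E * (1 - ρ)⁻¹ + E * (1 - ρ)⁻¹ := hle
    _ = gaussTailBound α T := by
        rw [gaussTailBound, ← hEdef, ← hρdef]
        field_simp
        ring


/-- Any sub-family of the shifted Gaussian is summable. [folklore] -/
theorem summable_gauss_indicator {α : ℝ} (hα : 0 < α) (c : ℝ) (p : ℤ → Prop) [DecidablePred p] :
    Summable fun k : ℤ => if p k then Real.exp (-π * α * ((k : ℝ) - c) ^ 2) else 0 := by
  classical
  refine ((summable_gauss_shift hα c).indicator {k | p k}).congr fun k => ?_
  by_cases h : p k <;> simp [h]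

/-! ### 3. `|φ′₁⟩ − |φ₁⟩` is the out-of-box tail of the line; the ℓ² bound -/

/-- Any sub-family of the line amplitudes is summable. [folklore] -/
theorem summable_lineAmp_indicator {a : ℂ} (ha : 0 < a.re) {x : Fin n → ℤ} (hx : x ≠ 0)
    (y : Fin n → ℤ) (p : ℤ → Prop) [DecidablePred p] :
    Summable fun k : ℤ => if p k then lineAmp a x y k else 0 := by
  classical
  refine ((summable_lineAmp ha hx y).indicator {k | p k}).congr fun k => ?_
  by_cases h : p k <;> simp [h]

/-- Any sub-family of the moduli of the line amplitudes is summable. [folklore] -/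
theorem summable_norm_lineAmp_indicator {a : ℂ} (ha : 0 < a.re) {x : Fin n → ℤ} (hx : x ≠ 0)
    (y : Fin n → ℤ) (p : ℤ → Prop) [DecidablePred p] :
    Summable fun k : ℤ => if p k then ‖lineAmp a x y k‖ else 0 := by
  classical
  refine ((summable_lineAmp ha hx y).norm.indicator {k | p k}).congr fun k => ?_
  by_cases h : p k <;> simp [h]

/-- **The tail identity.** `φ′₁(v) − φ₁(v) = Σ_{k : kx−y ≡ v (P), kx−y ∉ R·B_∞} e^{-πa‖kx−y‖²}`.
[cite: ChenQuantumLattice2024, Lemma 3.10 proof p. 24] -/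
theorem phi1Prime_sub_phi1 {P R : ℕ} {a : ℂ} (ha : 0 < a.re) {x : Fin n → ℤ} (hx : x ≠ 0)
    (y : Fin n → ℤ) (v : Fin n → ZMod P) :
    phi1Prime P a x y v - phi1 P R a x y v
      = ∑' k : ℤ, if linePt P x y k = v ∧ ¬ InBox R x y k then lineAmp a x y k else 0 := by
  rw [phi1Prime_apply, phi1, ← Summable.tsum_sub (summable_lineAmp_indicator ha hx y _)
    (summable_lineAmp_indicator ha hx y _)]
  refine tsum_congr fun k => ?_
  by_cases h1 : linePt P x y k = v <;> by_cases h2 : InBox R x y k <;> simp [h1, h2]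

/-- `|Σ_{p k} F(k)| ≤ Σ_{p k} |F(k)|`. [folklore] -/
theorem norm_tsum_ite_lineAmp_le {a : ℂ} (ha : 0 < a.re) {x : Fin n → ℤ} (hx : x ≠ 0)
    (y : Fin n → ℤ) (p : ℤ → Prop) [DecidablePred p] :
    ‖∑' k : ℤ, (if p k then lineAmp a x y k else 0)‖ ≤ ∑' k : ℤ, if p k then ‖lineAmp a x y k‖ else 0 := by
  have h := norm_tsum_le_tsum_norm (summable_lineAmp_indicator ha hx y p).norm
  refine h.trans_eq (tsum_congr fun k => ?_)
  split_ifs <;> simp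

/-- Fubini over the fibres of `k ↦ kx − y mod P`: `Σ_v Σ_{k ↦ v, p k} |F k| = Σ_{p k} |F k|`. [folklore] -/
theorem sum_tsum_fibre_norm_lineAmp {P : ℕ} [NeZero P] {a : ℂ} (ha : 0 < a.re) {x : Fin n → ℤ}
    (hx : x ≠ 0) (y : Fin n → ℤ) (p : ℤ → Prop) [DecidablePred p] :
    ∑ v : Fin n → ZMod P, ∑' k : ℤ, (if linePt P x y k = v ∧ p k then ‖lineAmp a x y k‖ else 0)
      = ∑' k : ℤ, if p k then ‖lineAmp a x y k‖ else 0 := by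
  classical
  have hs : ∀ v : Fin n → ZMod P, Summable fun k : ℤ =>
      (if linePt P x y k = v ∧ p k then ‖lineAmp a x y k‖ else 0) := by
    intro v
    refine ((summable_lineAmp ha hx y).norm.indicator {k | linePt P x y k = v ∧ p k}).congr
      fun k => ?_
    by_cases h1 : linePt P x y k = v <;> by_cases h2 : p k <;> simp [h1, h2]
  rw [← Summable.tsum_finsetSum (fun v _ => hs v)]
  refine tsum_congr fun k => ?_
  have h : ∀ v : Fin n → ZMod P, (if linePt P x y k = v ∧ p k then ‖lineAmp a x y k‖ else 0)
      = if linePt P x y k = v then (if p k then ‖lineAmp a x y k‖ else 0) else 0 := by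
    intro v
    by_cases h1 : linePt P x y k = v <;> by_cases h2 : p k <;> simp [h1, h2]
  simp_rw [h]
  rw [Finset.sum_ite_eq, if_pos (Finset.mem_univ _)]

/-- **ℓ² error ≤ (out-of-box mass)².**  `Σ_v |φ′₁(v) − φ₁(v)|² ≤ (Σ_{k : kx−y ∉ R·B_∞} |e^{-πa‖kx−y‖²}|)²`
(unconditionally: no hypothesis on `P` or on the outcome). [cite: ChenQuantumLattice2024, Lemma 3.10 proof p. 24] -/
theorem sum_norm_sq_phi1Prime_sub_phi1_le {P R : ℕ} [NeZero P] {a : ℂ} (ha : 0 < a.re)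
    {x : Fin n → ℤ} (hx : x ≠ 0) (y : Fin n → ℤ) :
    ∑ v, ‖phi1Prime P a x y v - phi1 P R a x y v‖ ^ 2
      ≤ (∑' k : ℤ, if ¬ InBox R x y k then ‖lineAmp a x y k‖ else 0) ^ 2 := by
  set t : (Fin n → ZMod P) → ℝ := fun v =>
    ∑' k : ℤ, if linePt P x y k = v ∧ ¬ InBox R x y k then ‖lineAmp a x y k‖ else 0 with ht
  set τ : ℝ := ∑' k : ℤ, if ¬ InBox R x y k then ‖lineAmp a x y k‖ else 0 with hτ
  have hτ' : ∑ v, t v = τ := sum_tsum_fibre_norm_lineAmp ha hx y (fun k => ¬ InBox R x y k)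
  have ht0 : ∀ v, 0 ≤ t v := fun v => tsum_nonneg fun k => by positivity
  have hD : ∀ v, ‖phi1Prime P a x y v - phi1 P R a x y v‖ ≤ t v := by
    intro v
    rw [phi1Prime_sub_phi1 ha hx y v]
    exact norm_tsum_ite_lineAmp_le ha hx y _
  have htle : ∀ v, t v ≤ τ := fun v => by
    rw [← hτ']
    exact Finset.single_le_sum (fun w _ => ht0 w) (Finset.mem_univ v)
  calc ∑ v, ‖phi1Prime P a x y v - phi1 P R a x y v‖ ^ 2 ≤ ∑ v, t v * τ := by
        refine Finset.sum_le_sum fun v _ => ?_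
        calc ‖phi1Prime P a x y v - phi1 P R a x y v‖ ^ 2 ≤ t v ^ 2 :=
              pow_le_pow_left₀ (norm_nonneg _) (hD v) 2
          _ = t v * t v := sq _
          _ ≤ t v * τ := mul_le_mul_of_nonneg_left (htle v) (ht0 v)
    _ = τ ^ 2 := by rw [← Finset.sum_mul, hτ', sq]

/-- **Good outcomes have a Gaussian out-of-box mass.** If every `k` with `|k − c| < T` lies in the box, then
`Σ_{kx−y ∉ R·B_∞} |e^{-πa‖kx−y‖²}| ≤ C₀ · B(α,T)`. [cite: ChenQuantumLattice2024, Lemma 2.6 p. 11] -/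
theorem outOfBox_mass_le {R : ℕ} {a : ℂ} (ha : 0 < a.re) {x : Fin n → ℤ} (hx : x ≠ 0) (y : Fin n → ℤ)
    {T : ℝ} (hT : 0 < T) (hgood : ∀ k : ℤ, |(k : ℝ) - lineCenter x y| < T → InBox R x y k) :
    (∑' k : ℤ, if ¬ InBox R x y k then ‖lineAmp a x y k‖ else 0)
      ≤ orthFactor a x y * gaussTailBound (lineRate a x) T := by
  have hα := lineRate_pos ha hx
  have hpt : ∀ k : ℤ, (if ¬ InBox R x y k then ‖lineAmp a x y k‖ else 0)
      ≤ orthFactor a x y * (if T ≤ |(k : ℝ) - lineCenter x y|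
          then Real.exp (-π * lineRate a x * ((k : ℝ) - lineCenter x y) ^ 2) else 0) := by
    intro k
    by_cases hk : InBox R x y k
    · rw [if_neg (not_not_intro hk)]
      have := orthFactor_pos a x y
      split_ifs <;> positivity
    · have hkc : T ≤ |(k : ℝ) - lineCenter x y| := not_lt.mp fun h => hk (hgood k h)
      rw [if_pos hk, if_pos hkc, norm_lineAmp a hx y k]
  calc (∑' k : ℤ, if ¬ InBox R x y k then ‖lineAmp a x y k‖ else 0)
      ≤ ∑' k : ℤ, orthFactor a x y * (if T ≤ |(k : ℝ) - lineCenter x y|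
          then Real.exp (-π * lineRate a x * ((k : ℝ) - lineCenter x y) ^ 2) else 0) :=
        Summable.tsum_le_tsum hpt (summable_norm_lineAmp_indicator ha hx y _)
          ((summable_gauss_indicator hα _ _).mul_left _)
    _ = orthFactor a x y * ∑' k : ℤ, (if T ≤ |(k : ℝ) - lineCenter x y|
          then Real.exp (-π * lineRate a x * ((k : ℝ) - lineCenter x y) ^ 2) else 0) := tsum_mul_left
    _ ≤ orthFactor a x y * gaussTailBound (lineRate a x) T :=
        mul_le_mul_of_nonneg_left (gauss_tail_le hα _ hT) (orthFactor_pos a x y).le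

/-! ### 4. Inside the box `k ↦ kx − y mod P` is injective (`2R < P`); the bulk term -/

/-- Two box points of the line with the same residue mod `P` coincide (`2R < P`, `x ≠ 0`).
[cite: ChenQuantumLattice2024, C.4 p. 19; §3.5.1 p. 23] -/
theorem eq_of_linePt_eq_of_inBox {P R : ℕ} {x : Fin n → ℤ} (hx : x ≠ 0) (hP : 2 * R < P) (y : Fin n → ℤ)
    {k k' : ℤ} (hk : InBox R x y k) (hk' : InBox R x y k') (h : linePt P x y k = linePt P x y k') :
    k = k' := by
  obtain ⟨i, hi⟩ := Function.ne_iff.mp hx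
  have hc := congr_fun h i
  simp only [linePt] at hc
  rw [ZMod.intCast_eq_intCast_iff_dvd_sub] at hc
  have hdvd : (P : ℤ) ∣ (k' - k) * x i := by
    have e : k' * x i - y i - (k * x i - y i) = (k' - k) * x i := by ring
    rw [← e]; exact hc
  have habs : |(k' - k) * x i| < P := by
    have h1 := hk i
    have h2 := hk' i
    have hRP : (R : ℤ) + R < P := by exact_mod_cast (show R + R < P by omega)
    calc |(k' - k) * x i| = |(k' * x i - y i) - (k * x i - y i)| := by ring_nf
      _ ≤ |k' * x i - y i| + |k * x i - y i| := abs_sub _ _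
      _ ≤ R + R := add_le_add h2 h1
      _ < P := hRP
  have h0 : (k' - k) * x i = 0 := Int.eq_zero_of_abs_lt_dvd hdvd habs
  rcases mul_eq_zero.mp h0 with h | h
  · omega
  · exact absurd h hi

/-- Hence inside the box `φ₁` has exactly one line term per register value:
`φ₁(k₁x − y mod P) = e^{-πa‖k₁x−y‖²}` for `k₁x − y` in the box. [cite: ChenQuantumLattice2024, §3.5.1 p. 23] -/
theorem phi1_apply_linePt {P R : ℕ} {a : ℂ} {x : Fin n → ℤ} (hx : x ≠ 0) (hP : 2 * R < P)
    (y : Fin n → ℤ) {k₁ : ℤ} (hk₁ : InBox R x y k₁) :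
    phi1 P R a x y (linePt P x y k₁) = lineAmp a x y k₁ := by
  simp only [phi1]
  rw [tsum_eq_single k₁]
  · rw [if_pos ⟨rfl, hk₁⟩]
  · intro k hk
    rw [if_neg]
    rintro ⟨h1, h2⟩
    exact hk (eq_of_linePt_eq_of_inBox hx hP y h2 hk₁ h1)

/-- The nearest-integer term is large: `|e^{-πa‖k₁x−y‖²}|² ≥ C₀² e^{-πα/2}` for `k₁ = round c`. [folklore] -/
theorem norm_sq_lineAmp_round_ge (a : ℂ) {x : Fin n → ℤ} (hx : x ≠ 0) (y : Fin n → ℤ) (ha : 0 ≤ a.re) :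
    orthFactor a x y ^ 2 * Real.exp (-(π * lineRate a x / 2))
      ≤ ‖lineAmp a x y (round (lineCenter x y))‖ ^ 2 := by
  rw [norm_lineAmp a hx y, mul_pow]
  refine mul_le_mul_of_nonneg_left ?_ (sq_nonneg _)
  rw [sq, ← Real.exp_add]
  apply Real.exp_le_exp.mpr
  have hr : |((round (lineCenter x y) : ℤ) : ℝ) - lineCenter x y| ≤ 1 / 2 := by
    rw [abs_sub_comm]; exact abs_sub_round _
  have hsq : (((round (lineCenter x y) : ℤ) : ℝ) - lineCenter x y) ^ 2 ≤ 1 / 4 := by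
    have h := (sq_le_sq' (by linarith [(abs_le.mp hr).1]) (abs_le.mp hr).2)
    linarith [h]
  have hα : 0 ≤ lineRate a x := mul_nonneg ha (dotProduct_self_pos_of_ne_zero hx).le
  have hπα : 0 ≤ π * lineRate a x := by positivity
  nlinarith

/-! ### 5. Lemma 3.10, corrected: an explicit relative ℓ² bound for good outcomes -/

/-- `δ(α,T) := e^{πα/4} · B(α,T) = 2e^{-πα(T² − 1/4)}/(1 − e^{-2παT})`: the relative ℓ² error of truncating
the line to the box, for an outcome whose box contains every `k` with `|k − c| < T`. [folklore] -/
def truncDelta (α T : ℝ) : ℝ := Real.exp (π * α / 4) * gaussTailBound α T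

/-- `δ(α,T) > 0`. [folklore] -/
theorem truncDelta_pos {α T : ℝ} (hα : 0 < α) (hT : 0 < T) : 0 < truncDelta α T :=
  mul_pos (Real.exp_pos _) (gaussTailBound_pos hα hT)

/-- **Lemma 3.10 with its `δ` (corrected statement).**  Let `Re a > 0`, `x ≠ 0`, `2R < P`, `T > 1/2`, and
suppose the outcome `y` is GOOD at scale `T`: every `k ∈ ℤ` with `|k − ⟨x,y⟩/‖x‖²| < T` has `kx − y ∈ R·B_∞ⁿ`.
Then, as unnormalised vectors of `ℂ^{ℤ_Pⁿ}`,
`‖ |φ′₁⟩ − |φ₁⟩ ‖₂² ≤ δ(α,T)² · ‖ |φ₁⟩ ‖₂²`, `α = Re(a)‖x‖²`, `δ(α,T) = 2e^{-πα(T²−1/4)}/(1 − e^{-2παT})`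
— the hypothesis of the state-robustness bound `abs_basisProb_sub_le` (Lemma 2.11 with `µ` made explicit).
The printed Lemma 3.10 asserts `≈_t` (negligible distance) for the fixed outcome with no condition on `y`;
see `lemma310_fails_at_bad_outcome` for outcomes where the two states are far apart.
[cite: ChenQuantumLattice2024, Lemma 3.10 p. 23; Lemma 2.11 p. 12; Lemma 2.6 p. 11] -/
theorem lemma310_corrected {P R : ℕ} [NeZero P] {a : ℂ} (ha : 0 < a.re) {x : Fin n → ℤ} (hx : x ≠ 0)
    (y : Fin n → ℤ) (hP : 2 * R < P) {T : ℝ} (hT : 1 / 2 < T)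
    (hgood : ∀ k : ℤ, |(k : ℝ) - lineCenter x y| < T → InBox R x y k) :
    ∑ v, ‖phi1Prime P a x y v - phi1 P R a x y v‖ ^ 2
      ≤ truncDelta (lineRate a x) T ^ 2 * ∑ v, ‖phi1 P R a x y v‖ ^ 2 := by
  have hT0 : 0 < T := by linarith
  have h1 := sum_norm_sq_phi1Prime_sub_phi1_le (P := P) (R := R) ha hx y
  have h2 := outOfBox_mass_le (R := R) ha hx y hT0 hgood
  have hτ0 : 0 ≤ ∑' k : ℤ, (if ¬ InBox R x y k then ‖lineAmp a x y k‖ else 0) :=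
    tsum_nonneg fun k => by positivity
  have hk₁ : InBox R x y (round (lineCenter x y)) := hgood _ (by
    have h := abs_sub_round (lineCenter x y)
    rw [abs_sub_comm] at h
    linarith)
  have h3 : ‖lineAmp a x y (round (lineCenter x y))‖ ^ 2 ≤ ∑ v, ‖phi1 P R a x y v‖ ^ 2 := by
    rw [← phi1_apply_linePt (a := a) hx hP y hk₁]
    exact Finset.single_le_sum (f := fun v => ‖phi1 P R a x y v‖ ^ 2) (fun v _ => by positivity)
      (Finset.mem_univ (linePt P x y (round (lineCenter x y))))
  have h4 := norm_sq_lineAmp_round_ge a hx y ha.le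
  have hexp : Real.exp (π * lineRate a x / 4) ^ 2 * Real.exp (-(π * lineRate a x / 2)) = 1 := by
    rw [sq, ← Real.exp_add, ← Real.exp_add,
      show π * lineRate a x / 4 + π * lineRate a x / 4 + -(π * lineRate a x / 2) = 0 by ring,
      Real.exp_zero]
  calc ∑ v, ‖phi1Prime P a x y v - phi1 P R a x y v‖ ^ 2
      ≤ (∑' k : ℤ, if ¬ InBox R x y k then ‖lineAmp a x y k‖ else 0) ^ 2 := h1
    _ ≤ (orthFactor a x y * gaussTailBound (lineRate a x) T) ^ 2 := pow_le_pow_left₀ hτ0 h2 2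
    _ = truncDelta (lineRate a x) T ^ 2
          * (orthFactor a x y ^ 2 * Real.exp (-(π * lineRate a x / 2))) := by
        rw [truncDelta, mul_pow, mul_pow]
        linear_combination (-(gaussTailBound (lineRate a x) T ^ 2 * orthFactor a x y ^ 2)) * hexp
    _ ≤ truncDelta (lineRate a x) T ^ 2 * ∑ v, ‖phi1 P R a x y v‖ ^ 2 :=
        mul_le_mul_of_nonneg_left (h4.trans h3) (sq_nonneg _)

/-- A sufficient condition for goodness at scale `T`, coordinate by coordinate:
`T·|xᵢ| + |(y_⊥)ᵢ| ≤ R` for all `i`, where `y_⊥ = y − c·x`. [folklore] -/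
theorem good_of_coordBound {R : ℕ} {x y : Fin n → ℤ} {T : ℝ}
    (h : ∀ i, T * |(x i : ℝ)| + |lineCenter x y * (x i : ℝ) - (y i : ℝ)| ≤ R) :
    ∀ k : ℤ, |(k : ℝ) - lineCenter x y| < T → InBox R x y k := by
  intro k hk i
  have key : |((k * x i - y i : ℤ) : ℝ)| ≤ R := by
    push_cast
    have e : (k : ℝ) * (x i : ℝ) - (y i : ℝ)
        = ((k : ℝ) - lineCenter x y) * (x i : ℝ) + (lineCenter x y * (x i : ℝ) - (y i : ℝ)) := by ring
    rw [e]
    calc |((k : ℝ) - lineCenter x y) * (x i : ℝ) + (lineCenter x y * (x i : ℝ) - (y i : ℝ))|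
        ≤ |((k : ℝ) - lineCenter x y) * (x i : ℝ)| + |lineCenter x y * (x i : ℝ) - (y i : ℝ)| :=
          abs_add_le _ _
      _ = |(k : ℝ) - lineCenter x y| * |(x i : ℝ)| + |lineCenter x y * (x i : ℝ) - (y i : ℝ)| := by
          rw [abs_mul]
      _ ≤ T * |(x i : ℝ)| + |lineCenter x y * (x i : ℝ) - (y i : ℝ)| := by
          gcongr
      _ ≤ R := h i
  exact_mod_cast key

/-! ### 6. Consequences: Step 2 (after `QFT_{ℤ_Pⁿ}`) and Born probabilities -/

/-- The same relative bound after Step 2's `QFT_{ℤ_Pⁿ}` (Plancherel). [cite: ChenQuantumLattice2024, eq. (18) p. 24] -/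
theorem lemma310_qft {P R : ℕ} [NeZero P] {a : ℂ} (ha : 0 < a.re) {x : Fin n → ℤ} (hx : x ≠ 0)
    (y : Fin n → ℤ) (hP : 2 * R < P) {T : ℝ} (hT : 1 / 2 < T)
    (hgood : ∀ k : ℤ, |(k : ℝ) - lineCenter x y| < T → InBox R x y k) :
    ∑ u, ‖qft (phi1Prime P a x y) u - qft (phi1 P R a x y) u‖ ^ 2
      ≤ truncDelta (lineRate a x) T ^ 2 * ∑ u, ‖qft (phi1 P R a x y) u‖ ^ 2 := by
  have h := lemma310_corrected ha hx y hP hT hgood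
  have e1 : ∀ u, qft (phi1Prime P a x y) u - qft (phi1 P R a x y) u
      = qft (phi1Prime P a x y - phi1 P R a x y) u := fun u => by rw [qft_sub]; rfl
  simp_rw [e1, qft_norm_sq_sum, Pi.sub_apply]
  calc ((P : ℝ)) ^ n * ∑ v, ‖phi1Prime P a x y v - phi1 P R a x y v‖ ^ 2
      ≤ ((P : ℝ)) ^ n * (truncDelta (lineRate a x) T ^ 2 * ∑ v, ‖phi1 P R a x y v‖ ^ 2) :=
        mul_le_mul_of_nonneg_left h (by positivity)
    _ = truncDelta (lineRate a x) T ^ 2 * (((P : ℝ)) ^ n * ∑ v, ‖phi1 P R a x y v‖ ^ 2) := by ring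

/-- **Born probabilities of good outcomes move by at most `4δ`** — before and after `QFT_{ℤ_Pⁿ}`, for every
set `V` of register values (the conclusion the algorithm's later steps consume). [cite: ChenQuantumLattice2024,
Lemma 3.10 p. 23; Lemma 2.11 p. 12] -/
theorem lemma310_basisProb {P R : ℕ} [NeZero P] {a : ℂ} (ha : 0 < a.re) {x : Fin n → ℤ} (hx : x ≠ 0)
    (y : Fin n → ℤ) (hP : 2 * R < P) {T : ℝ} (hT : 1 / 2 < T)
    (hgood : ∀ k : ℤ, |(k : ℝ) - lineCenter x y| < T → InBox R x y k) (V : Finset (Fin n → ZMod P)) :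
    |basisProb V (phi1Prime P a x y) - basisProb V (phi1 P R a x y)| ≤ 4 * truncDelta (lineRate a x) T
    ∧ |basisProb V (qft (phi1Prime P a x y)) - basisProb V (qft (phi1 P R a x y))|
        ≤ 4 * truncDelta (lineRate a x) T := by
  have hδ : 0 ≤ truncDelta (lineRate a x) T :=
    (truncDelta_pos (lineRate_pos ha hx) (by linarith)).le
  exact ⟨abs_basisProb_sub_le V _ _ hδ (lemma310_corrected ha hx y hP hT hgood),
    abs_basisProb_sub_le V _ _ hδ (lemma310_qft ha hx y hP hT hgood)⟩


/-! ### 7. The printed per-outcome Lemma 3.10 fails for outcomes at the boundary of the box -/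

/-- The all-ones direction `x = (1,…,1)`. [folklore] -/
def onesVec (n : ℕ) : Fin n → ℤ := fun _ => 1

/-- The offset `y = (−R, R, …, R)` (a legitimate Step-1 outcome: `y ∈ ℤⁿ ∩ R·B_∞ⁿ`). [cite: ChenQuantumLattice2024, Lemma 3.9 p. 22] -/
def badOffset (n R : ℕ) : Fin n → ℤ := fun i => if i.val = 0 then -(R : ℤ) else R

/-- `(1,…,1) ≠ 0`. [folklore] -/
theorem onesVec_ne_zero (m : ℕ) : onesVec (m + 3) ≠ 0 := by
  intro h
  have := congr_fun h 0
  simp [onesVec] at this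

/-- `(−R, R, …, R)` lies in the box `R·B_∞ⁿ` (it is a legitimate outcome). [cite: ChenQuantumLattice2024, Lemma 3.9 p. 22] -/
theorem badOffset_mem_box (m R : ℕ) (i : Fin (m + 3)) : |badOffset (m + 3) R i| ≤ R := by
  simp only [badOffset]
  split_ifs <;> simp

/-- For `x = 1`, `y = (−R,R,…,R)` the box `R·B_∞ⁿ` meets the line `{kx − y}` in the single point `k = 0`. [folklore] -/
theorem inBox_ones_bad_iff (m R : ℕ) (k : ℤ) :
    InBox R (onesVec (m + 3)) (badOffset (m + 3) R) k ↔ k = 0 := by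
  constructor
  · intro h
    have h0 := h ⟨0, by omega⟩
    have h1 := h ⟨1, by omega⟩
    simp only [onesVec, badOffset, mul_one] at h0 h1
    norm_num at h0 h1
    rw [abs_le] at h0 h1
    omega
  · rintro rfl i
    simp only [onesVec, badOffset, zero_mul, zero_sub, abs_neg]
    split_ifs <;> simp

/-- `‖(1,…,1)‖² = n`. [folklore] -/
theorem dot_onesVec_onesVec (m : ℕ) : (onesVec (m + 3) ⬝ᵥ onesVec (m + 3) : ℤ) = (m : ℤ) + 3 := by
  simp [onesVec, dotProduct]

/-- `⟨(1,…,1), (−R,R,…,R)⟩ = R(n − 2)`. [folklore] -/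
theorem dot_onesVec_badOffset (m R : ℕ) :
    (onesVec (m + 3) ⬝ᵥ badOffset (m + 3) R : ℤ) = (R : ℤ) * (m + 1) := by
  simp only [dotProduct, onesVec, badOffset, one_mul]
  rw [Fin.sum_univ_succ]
  simp [Fin.val_succ]
  ring

/-- `c = R(n−2)/n` for this outcome. [folklore] -/
theorem lineCenter_ones_bad (m R : ℕ) :
    lineCenter (onesVec (m + 3)) (badOffset (m + 3) R) = (R : ℝ) * (m + 1) / (m + 3) := by
  rw [lineCenter, dot_onesVec_badOffset, dot_onesVec_onesVec]
  push_cast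
  ring

/-- `α = n·Re a` along `(1,…,1)`. [folklore] -/
theorem lineRate_ones (m : ℕ) (a : ℂ) : lineRate a (onesVec (m + 3)) = a.re * (m + 3) := by
  rw [lineRate, dot_onesVec_onesVec]
  push_cast
  ring

/-- Along `x = 1` two line points have the same residue iff `P ∣ k′ − k`. [folklore] -/
theorem linePt_ones_eq_iff (P : ℕ) {m : ℕ} (y : Fin (m + 3) → ℤ) (k k' : ℤ) :
    linePt P (onesVec (m + 3)) y k = linePt P (onesVec (m + 3)) y k' ↔ (P : ℤ) ∣ k' - k := by
  constructor
  · intro h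
    have h0 := congr_fun h 0
    simp only [linePt, onesVec, mul_one] at h0
    rw [ZMod.intCast_eq_intCast_iff_dvd_sub] at h0
    simpa using h0
  · intro h
    funext i
    simp only [linePt, onesVec, mul_one]
    rw [ZMod.intCast_eq_intCast_iff_dvd_sub]
    simpa using h

/-- The truncated state of this outcome is a single basis vector (times `e^{-πa‖y‖²}`). [cite: ChenQuantumLattice2024, Lemma 3.9 p. 22] -/
theorem phi1_ones_bad_apply (P R : ℕ) (a : ℂ) (m : ℕ) (v : Fin (m + 3) → ZMod P) :
    phi1 P R a (onesVec (m + 3)) (badOffset (m + 3) R) v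
      = if linePt P (onesVec (m + 3)) (badOffset (m + 3) R) 0 = v
          then lineAmp a (onesVec (m + 3)) (badOffset (m + 3) R) 0 else 0 := by
  simp only [phi1, inBox_ones_bad_iff]
  rw [tsum_eq_single 0]
  · simp
  · intro k hk
    simp [hk]

/-- … so measuring it gives the register value `v₀ = −y mod P` with certainty. [cite: ChenQuantumLattice2024, Lemma 3.10 p. 23] -/
theorem basisProb_phi1_ones_bad (P R : ℕ) [NeZero P] (a : ℂ) (m : ℕ) :
    basisProb {linePt P (onesVec (m + 3)) (badOffset (m + 3) R) 0}
      (phi1 P R a (onesVec (m + 3)) (badOffset (m + 3) R)) = 1 := by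
  set v₀ := linePt P (onesVec (m + 3)) (badOffset (m + 3) R) 0 with hv₀
  have hφ := phi1_ones_bad_apply P R a m
  rw [basisProb, Finset.sum_singleton]
  have hden : ∑ u, ‖phi1 P R a (onesVec (m + 3)) (badOffset (m + 3) R) u‖ ^ 2
      = ‖phi1 P R a (onesVec (m + 3)) (badOffset (m + 3) R) v₀‖ ^ 2 := by
    rw [Finset.sum_eq_single v₀]
    · intro u _ hu
      rw [hφ u, if_neg (Ne.symm hu)]
      simp
    · intro h
      exact absurd (Finset.mem_univ _) h
  rw [hden]
  have hne : ‖phi1 P R a (onesVec (m + 3)) (badOffset (m + 3) R) v₀‖ ^ 2 ≠ 0 := by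
    rw [hφ v₀, if_pos rfl, lineAmp]
    exact pow_ne_zero _ (norm_ne_zero_iff.mpr (Complex.exp_ne_zero _))
  exact div_self hne

/-- At `v₀` the untruncated state only collects the line points `k ∈ Pℤ`, all at distance `≥ c` from the
centre `c = R(n−2)/n > 0` of the Gaussian: `|φ′₁(v₀)| ≤ C₀·B(α, c)`. [cite: ChenQuantumLattice2024, Lemma 3.10 p. 23] -/
theorem norm_phi1Prime_ones_bad_v0_le {P R : ℕ} {a : ℂ} (ha : 0 < a.re) (m : ℕ) (hR : 0 < R)
    (hP : 2 * R < P) :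
    ‖phi1Prime P a (onesVec (m + 3)) (badOffset (m + 3) R)
        (linePt P (onesVec (m + 3)) (badOffset (m + 3) R) 0)‖
      ≤ orthFactor a (onesVec (m + 3)) (badOffset (m + 3) R)
          * gaussTailBound (lineRate a (onesVec (m + 3)))
              (lineCenter (onesVec (m + 3)) (badOffset (m + 3) R)) := by
  set x := onesVec (m + 3) with hxdef
  set y := badOffset (m + 3) R with hydef
  have hx : x ≠ 0 := onesVec_ne_zero m
  have hc : lineCenter x y = (R : ℝ) * (m + 1) / (m + 3) := lineCenter_ones_bad m R
  have hm : (0 : ℝ) < m + 3 := by positivity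
  have hc0 : 0 < lineCenter x y := by
    rw [hc]
    have : (0 : ℝ) < R := by exact_mod_cast hR
    positivity
  have hcP : 2 * lineCenter x y ≤ P := by
    have h2 : (2 * R : ℝ) < P := by exact_mod_cast hP
    have h1 : (R : ℝ) * (m + 1) / (m + 3) ≤ R := by
      rw [div_le_iff₀ hm]
      have : (0 : ℝ) ≤ R := by positivity
      nlinarith
    rw [hc]
    linarith
  rw [phi1Prime_apply]
  refine (norm_tsum_ite_lineAmp_le ha hx y _).trans ?_
  have hpt : ∀ k : ℤ, (if linePt P x y k = linePt P x y 0 then ‖lineAmp a x y k‖ else 0)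
      ≤ orthFactor a x y * (if lineCenter x y ≤ |(k : ℝ) - lineCenter x y|
          then Real.exp (-π * lineRate a x * ((k : ℝ) - lineCenter x y) ^ 2) else 0) := by
    intro k
    by_cases hk : linePt P x y k = linePt P x y 0
    · have hdvd : (P : ℤ) ∣ k := by
        have h := (linePt_ones_eq_iff P y k 0).mp hk
        simpa using h
      have hfar : lineCenter x y ≤ |(k : ℝ) - lineCenter x y| := by
        by_cases hk0 : k = 0
        · subst hk0
          simp [abs_of_pos hc0]
        · have hkP : (P : ℤ) ≤ |k| := Int.le_of_dvd (abs_pos.mpr hk0) ((dvd_abs _ _).mpr hdvd)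
          have hkP' : (P : ℝ) ≤ |(k : ℝ)| := by exact_mod_cast hkP
          have h := abs_sub_abs_le_abs_sub (k : ℝ) (lineCenter x y)
          rw [abs_of_pos hc0] at h
          linarith
      rw [if_pos hk, if_pos hfar, norm_lineAmp a hx y k]
    · rw [if_neg hk]
      have := orthFactor_pos a x y
      split_ifs <;> positivity
  calc (∑' k : ℤ, if linePt P x y k = linePt P x y 0 then ‖lineAmp a x y k‖ else 0)
      ≤ ∑' k : ℤ, orthFactor a x y * (if lineCenter x y ≤ |(k : ℝ) - lineCenter x y|
          then Real.exp (-π * lineRate a x * ((k : ℝ) - lineCenter x y) ^ 2) else 0) :=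
        Summable.tsum_le_tsum hpt (summable_norm_lineAmp_indicator ha hx y _)
          ((summable_gauss_indicator (lineRate_pos ha hx) _ _).mul_left _)
    _ = orthFactor a x y * ∑' k : ℤ, (if lineCenter x y ≤ |(k : ℝ) - lineCenter x y|
          then Real.exp (-π * lineRate a x * ((k : ℝ) - lineCenter x y) ^ 2) else 0) := tsum_mul_left
    _ ≤ orthFactor a x y * gaussTailBound (lineRate a x) (lineCenter x y) :=
        mul_le_mul_of_nonneg_left (gauss_tail_le (lineRate_pos ha hx) _ hc0) (orthFactor_pos a x y).le

/-- At `v₁ = k₁x − y mod P`, `k₁ = round c`, the untruncated state is large: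
`|φ′₁(v₁)| ≥ C₀·(e^{-πα/4} − B(α, P − 1/2))` (main term minus the aliases `k ∈ k₁ + Pℤ∖{0}`). [cite: ChenQuantumLattice2024, Lemma 3.10 p. 23] -/
theorem norm_phi1Prime_ones_bad_v1_ge {P R : ℕ} {a : ℂ} (ha : 0 < a.re) (m : ℕ) (hP : 2 * R < P) :
    orthFactor a (onesVec (m + 3)) (badOffset (m + 3) R)
        * (Real.exp (-(π * lineRate a (onesVec (m + 3)) / 4))
            - gaussTailBound (lineRate a (onesVec (m + 3))) ((P : ℝ) - 1 / 2))
      ≤ ‖phi1Prime P a (onesVec (m + 3)) (badOffset (m + 3) R)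
          (linePt P (onesVec (m + 3)) (badOffset (m + 3) R)
            (round (lineCenter (onesVec (m + 3)) (badOffset (m + 3) R))))‖ := by
  set x := onesVec (m + 3) with hxdef
  set y := badOffset (m + 3) R with hydef
  have hx : x ≠ 0 := onesVec_ne_zero m
  set c := lineCenter x y with hcdef
  set k₁ : ℤ := round c with hk₁def
  have hP1 : (1 : ℝ) ≤ P := by exact_mod_cast (show 1 ≤ P by omega)
  have hT : 0 < (P : ℝ) - 1 / 2 := by linarith
  have hα := lineRate_pos ha hx
  have hr : |(k₁ : ℝ) - c| ≤ 1 / 2 := by rw [abs_sub_comm]; exact abs_sub_round c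
  -- split off the main term
  have hsg := summable_lineAmp_indicator ha hx y (fun k => linePt P x y k = linePt P x y k₁ ∧ k ≠ k₁)
  have hss := summable_lineAmp_indicator ha hx y (fun k => k = k₁)
  have hsingle : ∑' k : ℤ, (if k = k₁ then lineAmp a x y k else 0) = lineAmp a x y k₁ := by
    rw [tsum_eq_single k₁]
    · rw [if_pos rfl]
    · intro k hk
      rw [if_neg hk]
  have hsplit : phi1Prime P a x y (linePt P x y k₁)
      = lineAmp a x y k₁
        + ∑' k : ℤ, (if linePt P x y k = linePt P x y k₁ ∧ k ≠ k₁ then lineAmp a x y k else 0) := by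
    rw [phi1Prime_apply, ← hsingle, ← Summable.tsum_add hss hsg]
    refine tsum_congr fun k => ?_
    by_cases h1 : k = k₁
    · subst h1
      simp
    · by_cases h2 : linePt P x y k = linePt P x y k₁ <;> simp [h1, h2]
  -- the aliases are far from the centre
  have htail : ‖∑' k : ℤ, (if linePt P x y k = linePt P x y k₁ ∧ k ≠ k₁ then lineAmp a x y k else 0)‖
      ≤ orthFactor a x y * gaussTailBound (lineRate a x) ((P : ℝ) - 1 / 2) := by
    refine (norm_tsum_ite_lineAmp_le ha hx y _).trans ?_
    have hpt : ∀ k : ℤ, (if linePt P x y k = linePt P x y k₁ ∧ k ≠ k₁ then ‖lineAmp a x y k‖ else 0)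
        ≤ orthFactor a x y * (if (P : ℝ) - 1 / 2 ≤ |(k : ℝ) - c|
            then Real.exp (-π * lineRate a x * ((k : ℝ) - c) ^ 2) else 0) := by
      intro k
      by_cases hk : linePt P x y k = linePt P x y k₁ ∧ k ≠ k₁
      · have hdvd : (P : ℤ) ∣ k₁ - k := (linePt_ones_eq_iff P y k k₁).mp hk.1
        have hne : k₁ - k ≠ 0 := sub_ne_zero.mpr (Ne.symm hk.2)
        have hkP : (P : ℤ) ≤ |k₁ - k| := Int.le_of_dvd (abs_pos.mpr hne) ((dvd_abs _ _).mpr hdvd)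
        have hkP' : (P : ℝ) ≤ |(k₁ : ℝ) - k| := by exact_mod_cast hkP
        have hfar : (P : ℝ) - 1 / 2 ≤ |(k : ℝ) - c| := by
          have h := abs_sub_abs_le_abs_sub ((k : ℝ) - k₁) (c - k₁)
          rw [show (k : ℝ) - k₁ - (c - k₁) = k - c by ring, abs_sub_comm (k : ℝ) k₁,
            abs_sub_comm c (k₁ : ℝ)] at h
          linarith
        rw [if_pos hk, if_pos hfar, norm_lineAmp a hx y k]
      · rw [if_neg hk]
        have := orthFactor_pos a x y
        split_ifs <;> positivity
    calc (∑' k : ℤ, if linePt P x y k = linePt P x y k₁ ∧ k ≠ k₁ then ‖lineAmp a x y k‖ else 0)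
        ≤ ∑' k : ℤ, orthFactor a x y * (if (P : ℝ) - 1 / 2 ≤ |(k : ℝ) - c|
            then Real.exp (-π * lineRate a x * ((k : ℝ) - c) ^ 2) else 0) :=
          Summable.tsum_le_tsum hpt (summable_norm_lineAmp_indicator ha hx y _)
            ((summable_gauss_indicator hα _ _).mul_left _)
      _ = orthFactor a x y * ∑' k : ℤ, (if (P : ℝ) - 1 / 2 ≤ |(k : ℝ) - c|
            then Real.exp (-π * lineRate a x * ((k : ℝ) - c) ^ 2) else 0) := tsum_mul_left
      _ ≤ orthFactor a x y * gaussTailBound (lineRate a x) ((P : ℝ) - 1 / 2) :=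
          mul_le_mul_of_nonneg_left (gauss_tail_le hα c hT) (orthFactor_pos a x y).le
  -- the main term is large
  have hmain : orthFactor a x y * Real.exp (-(π * lineRate a x / 4)) ≤ ‖lineAmp a x y k₁‖ := by
    rw [norm_lineAmp a hx y k₁]
    refine mul_le_mul_of_nonneg_left (Real.exp_le_exp.mpr ?_) (orthFactor_pos a x y).le
    have hsq : ((k₁ : ℝ) - c) ^ 2 ≤ 1 / 4 := by
      have h := (sq_le_sq' (by linarith [(abs_le.mp hr).1]) (abs_le.mp hr).2)
      linarith [h]
    have hπα : 0 ≤ π * lineRate a x := by positivity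
    nlinarith
  -- combine with the reverse triangle inequality
  rw [hsplit]
  have hrev := norm_sub_le (lineAmp a x y k₁
      + ∑' k : ℤ, (if linePt P x y k = linePt P x y k₁ ∧ k ≠ k₁ then lineAmp a x y k else 0))
    (∑' k : ℤ, (if linePt P x y k = linePt P x y k₁ ∧ k ≠ k₁ then lineAmp a x y k else 0))
  rw [add_sub_cancel_right] at hrev
  rw [mul_sub]
  linarith

/-- **Lemma 3.10 as printed is false for this outcome.**  For `x = (1,…,1) ∈ ℤⁿ` (`n = m + 3 ≥ 3`),
`y = (−R, R, …, R) ∈ ℤⁿ ∩ R·B_∞ⁿ`, `0 < R`, `2R < P`, `Re a > 0`: the truncated `|φ₁⟩` yields the register value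
`v₀ = −y mod P` with probability `1`, while the untruncated `|φ′₁⟩` yields it with probability at most
`(B(α,c)/(e^{-πα/4} − B(α, P−½)))²`, `α = n·Re a`, `c = R(n−2)/n`, `B(α,T) = 2e^{-παT²}/(1−e^{-2παT})` —
exponentially small in `αc²` whenever the denominator is positive.  So `|φ′₁⟩ ≉ |φ₁⟩` for this outcome: the
printed per-outcome `≈_t` needs the qualifier "for all but a negligible fraction of Step-1 outcomes".
[cite: ChenQuantumLattice2024, Lemma 3.10 p. 23] -/
theorem lemma310_fails_at_bad_outcome {P R : ℕ} [NeZero P] {a : ℂ} (ha : 0 < a.re) (m : ℕ) (hR : 0 < R)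
    (hP : 2 * R < P)
    (hden : gaussTailBound (a.re * (m + 3)) ((P : ℝ) - 1 / 2) < Real.exp (-(π * (a.re * (m + 3)) / 4))) :
    basisProb {linePt P (onesVec (m + 3)) (badOffset (m + 3) R) 0}
        (phi1 P R a (onesVec (m + 3)) (badOffset (m + 3) R)) = 1
    ∧ basisProb {linePt P (onesVec (m + 3)) (badOffset (m + 3) R) 0}
        (phi1Prime P a (onesVec (m + 3)) (badOffset (m + 3) R))
      ≤ (gaussTailBound (a.re * (m + 3)) ((R : ℝ) * (m + 1) / (m + 3))
          / (Real.exp (-(π * (a.re * (m + 3)) / 4))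
              - gaussTailBound (a.re * (m + 3)) ((P : ℝ) - 1 / 2))) ^ 2 := by
  refine ⟨basisProb_phi1_ones_bad P R a m, ?_⟩
  set x := onesVec (m + 3) with hxdef
  set y := badOffset (m + 3) R with hydef
  have hx : x ≠ 0 := onesVec_ne_zero m
  have hc : lineCenter x y = (R : ℝ) * (m + 1) / (m + 3) := lineCenter_ones_bad m R
  have hα : lineRate a x = a.re * (m + 3) := lineRate_ones m a
  rw [← hc, ← hα]
  rw [← hα] at hden
  set v₀ := linePt P x y 0
  set v₁ := linePt P x y (round (lineCenter x y))
  set C₀ := orthFactor a x y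
  set N := C₀ * gaussTailBound (lineRate a x) (lineCenter x y) with hN
  set D := C₀ * (Real.exp (-(π * lineRate a x / 4)) - gaussTailBound (lineRate a x) ((P : ℝ) - 1 / 2))
    with hD
  have hC₀ : 0 < C₀ := orthFactor_pos a x y
  have hD0 : 0 < D := mul_pos hC₀ (by linarith)
  have hnum : ‖phi1Prime P a x y v₀‖ ≤ N := norm_phi1Prime_ones_bad_v0_le ha m hR hP
  have hN0 : 0 ≤ N := (norm_nonneg _).trans hnum
  have hv₁ : D ≤ ‖phi1Prime P a x y v₁‖ := norm_phi1Prime_ones_bad_v1_ge ha m hP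
  have hsum : D ^ 2 ≤ ∑ u, ‖phi1Prime P a x y u‖ ^ 2 :=
    (pow_le_pow_left₀ hD0.le hv₁ 2).trans
      (Finset.single_le_sum (f := fun u => ‖phi1Prime P a x y u‖ ^ 2) (fun u _ => by positivity)
        (Finset.mem_univ v₁))
  rw [basisProb, Finset.sum_singleton]
  calc ‖phi1Prime P a x y v₀‖ ^ 2 / ∑ u, ‖phi1Prime P a x y u‖ ^ 2 ≤ N ^ 2 / D ^ 2 :=
        div_le_div₀ (sq_nonneg _) (pow_le_pow_left₀ (norm_nonneg _) hnum 2) (pow_pos hD0 2) hsum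
    _ = (gaussTailBound (lineRate a x) (lineCenter x y)
          / (Real.exp (-(π * lineRate a x / 4)) - gaussTailBound (lineRate a x) ((P : ℝ) - 1 / 2))) ^ 2 := by
        rw [hN, hD, mul_pow, mul_pow, mul_div_mul_left _ _ (pow_ne_zero 2 hC₀.ne'), div_pow]

/-! ### 8. A numerical instance: `n = 3`, `R = 15`, `P = 31`, `a = 1/3` -/

/-- `e^{-1} < 0.37`. [folklore] -/
theorem exp_neg_one_lt_037 : Real.exp (-1) < 0.37 := lt_trans Real.exp_neg_one_lt_d9 (by norm_num)

/-- `B(1,T) ≤ 2·0.37^j/0.63` whenever `j ≤ πT²` and `T ≥ 1/2`. [folklore] -/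
theorem gaussTailBound_one_le {T : ℝ} {j : ℕ} (hT : 1 / 2 ≤ T) (hj : (j : ℝ) ≤ π * T ^ 2) :
    gaussTailBound 1 T ≤ 2 * 0.37 ^ j / 0.63 := by
  have hE := exp_neg_one_lt_037
  have h1 : Real.exp (-π * 1 * T ^ 2) ≤ 0.37 ^ j := by
    calc Real.exp (-π * 1 * T ^ 2) ≤ Real.exp (-(j : ℝ)) := Real.exp_le_exp.mpr (by linarith)
      _ = Real.exp (-1) ^ j := by rw [← Real.exp_nat_mul]; ring_nf
      _ ≤ 0.37 ^ j := pow_le_pow_left₀ (Real.exp_pos _).le hE.le j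
  have h2 : 0.63 ≤ 1 - Real.exp (-2 * π * 1 * T) := by
    have : Real.exp (-2 * π * 1 * T) ≤ Real.exp (-1) :=
      Real.exp_le_exp.mpr (by nlinarith [Real.pi_gt_three])
    linarith
  unfold gaussTailBound
  exact div_le_div₀ (by positivity) (by linarith) (by norm_num) h2

/-- `e^{-π/4} ≥ 0.2125` (`e^x ≥ 1 + x`, `π < 3.15`). [folklore] -/
theorem exp_neg_pi_div_four_ge : 0.2125 ≤ Real.exp (-(π * 1 / 4)) := by
  have h := Real.add_one_le_exp (-(π * 1 / 4))
  have hπ := Real.pi_lt_d2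
  linarith

/-- **Numbers.** `n = 3`, `x = (1,1,1)`, `R = 15`, `y = (−15, 15, 15)`, `P = 31 > 2R`, `a = 1/3` (`α = 1`,
`c = 5`): `Pr_{φ₁}[v₀] = 1` but `Pr_{φ′₁}[v₀] < 2^{-200}`. [cite: ChenQuantumLattice2024, Lemma 3.10 p. 23] -/
theorem lemma310_fails_numeric :
    basisProb {linePt 31 (onesVec 3) (badOffset 3 15) 0}
        (phi1 31 15 (((1 / 3 : ℝ)) : ℂ) (onesVec 3) (badOffset 3 15)) = 1
    ∧ basisProb {linePt 31 (onesVec 3) (badOffset 3 15) 0}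
        (phi1Prime 31 (((1 / 3 : ℝ)) : ℂ) (onesVec 3) (badOffset 3 15)) < 1 / 2 ^ 200 := by
  have ha : 0 < (((1 / 3 : ℝ)) : ℂ).re := by rw [Complex.ofReal_re]; norm_num
  have hα : (((1 / 3 : ℝ)) : ℂ).re * ((0 : ℕ) + 3 : ℝ) = 1 := by rw [Complex.ofReal_re]; norm_num
  have hπ := Real.pi_gt_three
  have hnum : gaussTailBound 1 5 ≤ 2 * 0.37 ^ 75 / 0.63 :=
    gaussTailBound_one_le (by norm_num) (by norm_num; nlinarith)
  have htl : gaussTailBound 1 (61 / 2) ≤ 2 * 0.37 ^ 4 / 0.63 :=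
    gaussTailBound_one_le (by norm_num) (by norm_num; nlinarith)
  have he := exp_neg_pi_div_four_ge
  have hB0 : 0 ≤ gaussTailBound 1 5 := (gaussTailBound_pos one_pos (by norm_num)).le
  have hden' : (0.2125 : ℝ) - 2 * 0.37 ^ 4 / 0.63
      ≤ Real.exp (-(π * 1 / 4)) - gaussTailBound 1 (61 / 2) := by linarith
  have hdpos : (0 : ℝ) < 0.2125 - 2 * 0.37 ^ 4 / 0.63 := by norm_num
  have h := lemma310_fails_at_bad_outcome (P := 31) (R := 15) ha 0 (by norm_num) (by norm_num) (by
    rw [hα]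
    have : ((31 : ℕ) : ℝ) - 1 / 2 = 61 / 2 := by norm_num
    rw [this]
    linarith)
  refine ⟨h.1, h.2.trans_lt ?_⟩
  rw [hα]
  have e1 : ((15 : ℕ) : ℝ) * ((0 : ℕ) + 1) / ((0 : ℕ) + 3) = 5 := by norm_num
  have e2 : ((31 : ℕ) : ℝ) - 1 / 2 = 61 / 2 := by norm_num
  rw [e1, e2]
  calc (gaussTailBound 1 5 / (Real.exp (-(π * 1 / 4)) - gaussTailBound 1 (61 / 2))) ^ 2
      ≤ ((2 * 0.37 ^ 75 / 0.63) / (0.2125 - 2 * 0.37 ^ 4 / 0.63)) ^ 2 := by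
        refine pow_le_pow_left₀ (div_nonneg hB0 (hdpos.le.trans hden')) ?_ 2
        exact div_le_div₀ (by positivity) hnum hdpos hden'
    _ < 1 / 2 ^ 200 := by norm_num

end

end Literature.Computability.Cryptography.Chen2024
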